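import Mathlib
import HarnessLib
import Summits.Ventures.LatticeQCDFlow.Scaling.AutoregressiveGaugeForestLoss
import Literature.NumberTheory.Automorphic.AutomorphicRepsGLLogDetCounterexample

/-!
# LatticeQCDFlow / Scaling — extensive training-loss floors, THE CONTEXT-FREE CASE: both relative
# entropies between a lattice gauge theory and an independent-links proposal are at least the SUM over
# a forest of one-link divergences from Haar — linear in `L^d`

HONEST FRAMING: exact (Metropolis-corrected) sampling algorithms for lattice gauge theory;
figures of merit are autocorrelation/cost numbers at stated couplings and volumes; no
continuum-physics claim.

Venture `LatticeQCDFlow` (cell pub-lqcd), topic `Scaling`, FANOUT row 30 (lean-1, GEN-19) — OUR WORK,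
companion of `Scaling/AutoregressiveGaugeForestLoss` (`forest_kl_fwd_ge`: `D(p‖Q) ≥ −∫ log(A_s Q) dπ`;
`forest_kl_rev_ge`: `D(Q‖p) ≥ ∫ A_sQ·log(A_sQ) dπ`, for every squeezed proposal density `Q` and every
forest), specialised to CONTEXT-FREE proposals `Q(U) = ∏_a q_a(U_a)` (links drawn independently from
one-link densities `0 < c_q ≤ q_a ≤ C_q`, `∫ q_a dHaar = 1`).

## What is proved (all [ours])

* §1 `coordAvg_prod_single` (`A_s(∏_a q_a(U_a)) = ∏_{a∉s} q_a(U_a)`), `pi_integral_comp_eval`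
  (`∫ h(U_a) dπ = ∫ h dμ`), `pi_integral_prod_mul_log` (`∫ (∏_{b∈T} q_b(U_b))·log q_a(U_a) dπ = ∫ q_a log q_a`).
* §2 **`forest_kl_fwd_ge_sum`** — `∫ p log(p/Q) dπ ≥ Σ_{a ∈ T} (−∫ log q_a dHaar) = Σ_{a∈T} KL(Haar‖q_a)`;
  **`forest_kl_rev_ge_sum`** — `∫ Q log(Q/p) dπ ≥ Σ_{a ∈ T} ∫ q_a log q_a dHaar = Σ_{a∈T} KL(q_a‖Haar)`.

READING (value-free): over a spanning tree (`L^d − 1` links) the training loss of an independent-links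
model, in either direction, is at least `(L^d − 1)·κ` with `κ` the smallest one-link divergence from Haar:
EXTENSIVE IN THE VOLUME for every compact gauge group, dimension and coupling.  NOT CLAIMED: models with
context; the flat model.  No `def`, no `sorry`, nothing cited as a fact.
-/

noncomputable section

namespace Summit.Ventures.LatticeQCDFlow.Theory2.Autoregressive

open MeasureTheory Function Set
open Literature.MathematicalPhysics.QuantumFieldTheory
open Summit.Ventures.LatticeQCDFlow.Exactness

/-! ## §1 Product bookkeeping -/

section General

variable {ι : Type*} [Fintype ι] [DecidableEq ι] {X : Type*} [MeasurableSpace X]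
variable (μ : Measure X) [IsProbabilityMeasure μ]

omit [DecidableEq ι] in
/-- `∫ h(U_a) dπ(U) = ∫ h dμ` (the one-coordinate marginal of the product). [folklore] -/
theorem pi_integral_comp_eval (a : ι) {h : X → ℝ} (hm : Measurable h) :
    ∫ U, h (U a) ∂Measure.pi (fun _ : ι => μ) = ∫ v, h v ∂μ := by
  have hev := (measurePreserving_eval (fun _ : ι => μ) a).map_eq
  calc ∫ U, h (U a) ∂Measure.pi (fun _ : ι => μ)
      = ∫ v, h v ∂(Measure.map (eval a) (Measure.pi fun _ : ι => μ)) :=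
        (integral_map (measurable_pi_apply a).aemeasurable hm.aestronglyMeasurable).symm
    _ = ∫ v, h v ∂μ := by rw [hev]

/-- **Entropy of a product**: for one-coordinate probability densities `q_b` and a finite set `T`,
`∫ (∏_{b∈T} q_b(U_b))·log q_a(U_a) dπ = ∫ q_a log q_a dμ` for `a ∈ T`. [ours] -/
theorem pi_integral_prod_mul_log {q : ι → X → ℝ} (hq1 : ∀ a, ∫ v, q a v ∂μ = 1)
    (T : Finset ι) {a : ι} (ha : a ∈ T) :
    ∫ U, (∏ b ∈ T, q b (U b)) * Real.log (q a (U a)) ∂Measure.pi (fun _ : ι => μ) =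
      ∫ v, q a v * Real.log (q a v) ∂μ := by
  -- write the integrand as a full product of one-coordinate factors
  have e : ∀ U : ι → X, (∏ b ∈ T, q b (U b)) * Real.log (q a (U a)) =
      ∏ b, (if b = a then q b (U b) * Real.log (q b (U b)) else if b ∈ T then q b (U b) else 1) := by
    intro U
    rw [← Finset.mul_prod_erase T (fun b => q b (U b)) ha,
      ← Finset.mul_prod_erase Finset.univ _ (Finset.mem_univ a)]
    simp only [if_true]
    have h3 : ∀ b ∈ Finset.univ.erase a, (if b = a then q b (U b) * Real.log (q b (U b))
        else if b ∈ T then q b (U b) else 1) = (if b ∈ T then q b (U b) else 1) := fun b hb => by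
      simp [Finset.ne_of_mem_erase hb]
    have h4 : Finset.univ.erase a ∩ T = T.erase a := by
      ext b; simp [Finset.mem_erase]
    rw [Finset.prod_congr rfl h3, Finset.prod_ite_mem, h4]
    ring
  simp_rw [e]
  have h5 := MeasureTheory.integral_fintype_prod_eq_prod (𝕜 := ℝ) (μ := fun _ : ι => μ)
    (fun b (v : X) => if b = a then q b v * Real.log (q b v) else if b ∈ T then q b v else (1 : ℝ))
  rw [h5, ← Finset.mul_prod_erase Finset.univ _ (Finset.mem_univ a)]
  simp only [if_true]
  have h6 : ∀ b ∈ Finset.univ.erase a, (∫ v, (if b = a then q b v * Real.log (q b v)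
      else if b ∈ T then q b v else (1 : ℝ)) ∂μ) = 1 := by
    intro b hb
    have hba : b ≠ a := Finset.ne_of_mem_erase hb
    by_cases hbT : b ∈ T
    · simp only [hba, if_false, hbT, if_true, hq1 b]
    · simp [hba, hbT]
  rw [Finset.prod_eq_one h6, mul_one]

end General

/-! ## §2 The sums -/

section Gauge

variable {d L : ℕ} {G : Type*} [Group G] [TopologicalSpace G] [IsTopologicalGroup G] [CompactSpace G]
  [MeasurableSpace G] [BorelSpace G] [NeZero L]

omit [Group G] [TopologicalSpace G] [IsTopologicalGroup G] [CompactSpace G] [BorelSpace G] in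
/-- Bookkeeping for a context-free proposal: measurability and the squeeze
`c_q^{#E} ≤ ∏_a q_a(U_a) ≤ (max C_q 1)^{#E}`. [ours] -/
theorem prodProposal_props {q : Edge d L → G → ℝ} (hqm : ∀ a, Measurable (q a)) {cq Cq : ℝ} (hcq : 0 < cq)
    (hqlo : ∀ a v, cq ≤ q a v) (hqhi : ∀ a v, q a v ≤ Cq) :
    Measurable (fun U : GaugeConfig d L G => ∏ a, q a (U a)) ∧
      (∀ U : GaugeConfig d L G, cq ^ Fintype.card (Edge d L) ≤ ∏ a, q a (U a)) ∧
      ∀ U : GaugeConfig d L G, ∏ a, q a (U a) ≤ (max Cq 1) ^ Fintype.card (Edge d L) := by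
  refine ⟨Finset.measurable_prod _ fun a _ => (hqm a).comp (measurable_pi_apply a), fun U => ?_, fun U => ?_⟩
  · rw [← Finset.card_univ, ← Finset.prod_const]
    exact Finset.prod_le_prod (fun a _ => hcq.le) (fun a _ => hqlo a _)
  · rw [← Finset.card_univ, ← Finset.prod_const]
    exact Finset.prod_le_prod (fun a _ => hcq.le.trans (hqlo a _)) (fun a _ => (hqhi a _).trans (le_max_left _ _))

set_option maxHeartbeats 400000 in
/-- **FORWARD, CONTEXT-FREE: `D(p ‖ ∏ q_a) ≥ Σ_{a ∈ T} KL(Haar ‖ q_a) = Σ_{a∈T} (−∫ log q_a dHaar)`.** [ours] -/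
theorem forest_kl_fwd_ge_sum {F : GaugeConfig d L G → ℝ} (hF : IsGaugeInvariant F) (hFm : Measurable F)
    {cF CF : ℝ} (hcF : 0 < cF) (hFlo : ∀ U, cF ≤ F U) (hFhi : ∀ U, F U ≤ CF)
    (T : List (Edge d L × Site d L))
    (hinc : ∀ p ∈ T, (p.1.1 = p.2 ∨ p.1.1.shift p.1.2 = p.2) ∧ p.1.1 ≠ p.1.1.shift p.1.2)
    (hpw : T.Pairwise (fun p q => ¬ (q.1.1 = p.2 ∨ q.1.1.shift q.1.2 = p.2)))
    {q : Edge d L → G → ℝ} (hqm : ∀ a, Measurable (q a)) {cq Cq : ℝ} (hcq : 0 < cq)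
    (hqlo : ∀ a v, cq ≤ q a v) (hqhi : ∀ a v, q a v ≤ Cq) (hq1 : ∀ a, ∫ v, q a v ∂(haarProbability G) = 1) :
    ∑ a ∈ (T.map Prod.fst).toFinset, (-∫ v, Real.log (q a v) ∂(haarProbability G)) ≤
      ∫ U, F U / (∫ W, F W ∂Measure.pi (fun _ : Edge d L => haarProbability G)) *
        Real.log ((F U / ∫ W, F W ∂Measure.pi (fun _ : Edge d L => haarProbability G)) / ∏ a, q a (U a))
        ∂Measure.pi (fun _ : Edge d L => haarProbability G) := by
  classical
  obtain ⟨hQm, hQlo, hQhi⟩ := prodProposal_props (L := L) hqm hcq hqlo hqhi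
  have h := forest_kl_fwd_ge hF hFm hcF hFlo hFhi T hinc hpw hQm (pow_pos hcq _) hQlo hQhi
  refine le_trans (le_of_eq ?_) h
  -- `−∫ log(A_s Q) = −∫ Σ_{a∈T} log q_a(U_a) = Σ_{a∈T} −∫ log q_a`
  have hq0 : ∀ a v, 0 < q a v := fun a v => hcq.trans_le (hqlo a v)
  have hmarg : ∀ U : GaugeConfig d L G, coordAvg (haarProbability G) (Finset.univ \ (T.map Prod.fst).toFinset) (fun W => ∏ a, q a (W a)) U =
      ∏ a ∈ (T.map Prod.fst).toFinset, q a (U a) := fun U => by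
    rw [coordAvg_prod_single (haarProbability G) _ hq1 U,
      Finset.sdiff_sdiff_eq_self (Finset.subset_univ _)]
  have hlog : ∀ U : GaugeConfig d L G, Real.log (∏ a ∈ (T.map Prod.fst).toFinset, q a (U a)) = ∑ a ∈ (T.map Prod.fst).toFinset, Real.log (q a (U a)) :=
    fun U => Real.log_prod (fun a _ => (hq0 a _).ne')
  have hlb : ∀ a, ∀ v : G, |Real.log (q a v)| ≤ Cq + cq⁻¹ := fun a v =>
    (Literature.NumberTheory.Automorphic.abs_log_le_add_inv (hq0 a v)).trans (add_le_add (hqhi a v) (inv_anti₀ hcq (hqlo a v)))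
  have hint : ∀ a ∈ (T.map Prod.fst).toFinset, Integrable (fun U : GaugeConfig d L G => Real.log (q a (U a)))
      (Measure.pi fun _ : Edge d L => haarProbability G) := fun a _ =>
    integrable_of_bounded_measurable ((Real.measurable_log.comp (hqm a)).comp (measurable_pi_apply a)) (fun U => hlb a _)
  simp_rw [hmarg, hlog]
  rw [integral_finsetSum _ hint, ← Finset.sum_neg_distrib]
  refine Finset.sum_congr rfl fun a _ => ?_
  rw [← pi_integral_comp_eval (haarProbability G) a (h := fun v => Real.log (q a v))
    (Real.measurable_log.comp (hqm a))]

set_option maxHeartbeats 400000 in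
/-- **REVERSE, CONTEXT-FREE (the flow's training loss): `D(∏ q_a ‖ p) ≥ Σ_{a ∈ T} KL(q_a ‖ Haar) =
Σ_{a∈T} ∫ q_a log q_a dHaar`.** [ours] -/
theorem forest_kl_rev_ge_sum {F : GaugeConfig d L G → ℝ} (hF : IsGaugeInvariant F) (hFm : Measurable F)
    {cF CF : ℝ} (hcF : 0 < cF) (hFlo : ∀ U, cF ≤ F U) (hFhi : ∀ U, F U ≤ CF)
    (T : List (Edge d L × Site d L))
    (hinc : ∀ p ∈ T, (p.1.1 = p.2 ∨ p.1.1.shift p.1.2 = p.2) ∧ p.1.1 ≠ p.1.1.shift p.1.2)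
    (hpw : T.Pairwise (fun p q => ¬ (q.1.1 = p.2 ∨ q.1.1.shift q.1.2 = p.2)))
    {q : Edge d L → G → ℝ} (hqm : ∀ a, Measurable (q a)) {cq Cq : ℝ} (hcq : 0 < cq)
    (hqlo : ∀ a v, cq ≤ q a v) (hqhi : ∀ a v, q a v ≤ Cq) (hq1 : ∀ a, ∫ v, q a v ∂(haarProbability G) = 1) :
    ∑ a ∈ (T.map Prod.fst).toFinset, ∫ v, q a v * Real.log (q a v) ∂(haarProbability G) ≤
      ∫ U, (∏ a, q a (U a)) *
        Real.log ((∏ a, q a (U a)) / (F U / ∫ W, F W ∂Measure.pi (fun _ : Edge d L => haarProbability G)))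
        ∂Measure.pi (fun _ : Edge d L => haarProbability G) := by
  classical
  obtain ⟨hQm, hQlo, hQhi⟩ := prodProposal_props (L := L) hqm hcq hqlo hqhi
  have h := forest_kl_rev_ge hF hFm hcF hFlo hFhi T hinc hpw hQm (pow_pos hcq _) hQlo hQhi
  refine le_trans (le_of_eq ?_) h
  have hq0 : ∀ a v, 0 < q a v := fun a v => hcq.trans_le (hqlo a v)
  have hmarg : ∀ U : GaugeConfig d L G, coordAvg (haarProbability G) (Finset.univ \ (T.map Prod.fst).toFinset) (fun W => ∏ a, q a (W a)) U =
      ∏ a ∈ (T.map Prod.fst).toFinset, q a (U a) := fun U => by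
    rw [coordAvg_prod_single (haarProbability G) _ hq1 U,
      Finset.sdiff_sdiff_eq_self (Finset.subset_univ _)]
  have hlog : ∀ U : GaugeConfig d L G, Real.log (∏ a ∈ (T.map Prod.fst).toFinset, q a (U a)) = ∑ a ∈ (T.map Prod.fst).toFinset, Real.log (q a (U a)) :=
    fun U => Real.log_prod (fun a _ => (hq0 a _).ne')
  have hlb : ∀ a, ∀ v : G, |Real.log (q a v)| ≤ Cq + cq⁻¹ := fun a v =>
    (Literature.NumberTheory.Automorphic.abs_log_le_add_inv (hq0 a v)).trans (add_le_add (hqhi a v) (inv_anti₀ hcq (hqlo a v)))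
  have hP0 : ∀ U : GaugeConfig d L G, 0 ≤ ∏ a ∈ (T.map Prod.fst).toFinset, q a (U a) := fun U => Finset.prod_nonneg fun a _ => (hq0 a _).le
  have hPb : ∀ U : GaugeConfig d L G, ∏ a ∈ (T.map Prod.fst).toFinset, q a (U a) ≤ (max Cq 1) ^ (T.map Prod.fst).toFinset.card := fun U => by
    rw [← Finset.prod_const]
    exact Finset.prod_le_prod (fun a _ => (hq0 a _).le) (fun a _ => (hqhi a _).trans (le_max_left _ _))
  have hPm : Measurable fun U : GaugeConfig d L G => ∏ a ∈ (T.map Prod.fst).toFinset, q a (U a) :=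
    Finset.measurable_prod _ fun a _ => (hqm a).comp (measurable_pi_apply a)
  have hint : ∀ a ∈ (T.map Prod.fst).toFinset, Integrable (fun U : GaugeConfig d L G => (∏ b ∈ (T.map Prod.fst).toFinset, q b (U b)) * Real.log (q a (U a)))
      (Measure.pi fun _ : Edge d L => haarProbability G) := fun a _ =>
    integrable_of_bounded_measurable (hPm.mul ((Real.measurable_log.comp (hqm a)).comp (measurable_pi_apply a)))
      (C := (max Cq 1) ^ (T.map Prod.fst).toFinset.card * (Cq + cq⁻¹)) (fun U => by
        rw [abs_mul, abs_of_nonneg (hP0 U)]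
        exact mul_le_mul (hPb U) (hlb a _) (abs_nonneg _) (pow_nonneg (le_max_right _ _ |>.trans' zero_le_one) _))
  simp_rw [hmarg, hlog, Finset.mul_sum]
  rw [integral_finsetSum _ hint]
  refine Finset.sum_congr rfl fun a ha => ?_
  exact (pi_integral_prod_mul_log (haarProbability G) hq1 _ ha).symm

end Gauge

end Summit.Ventures.LatticeQCDFlow.Theory2.Autoregressive

end
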